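import Summits.QuantumFields.YangMills.Theorems.UnitScaleTiltFluctuationComparisonRegPrLiftLegsTransverse
import Summits.QuantumFields.YangMills.Theorems.UnitScaleTiltFluctuationComparisonRegPrAnsatzTKernel

/-!
# Route `UnitScaleTilt` — crux `FluctuationComparisonRegPrL` (stmt-QuantumFields-19935; formerly 19201), stub `stub_oneStepSmallLift`: the Γ-LEG LAYER,
# file 10 — JUNCTION WITH «ANSATZ T» AND THE ∀-L GLUE (support file `--supports stmt-QuantumFields-19935`)

Cell `ym3-torus` (HUMAN RULING D-0037, YM ladder rung R3), seat `ym3-torus-p1` gen 11 (UV side; cell memo HOME/UV3-NODE.md §20).  Two one-liners that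
fix the junction of the three lineages working `stub_oneStepSmallLift`:

* `lineNeutral_of_sliceNeutral`: ym3-torus-p2 g10's `AnsatzT.SliceNeutral` (p-file `…AnsatzTKernel`, proved for the tensor table `kzT L` as
  `sliceNeutral_T`) is literally this lineage's `TransverseNeutral` (`…LiftLegsTransverse`), hence gives `LineNeutral` — the accuracy hypothesis of
  `exists_approxSmallLift_of_kernel_lineNeutral` (`…LiftLegsAssembly`).
* **`oneStepSmallLift_stub_of_perL`**: the registered signature of `stub_oneStepSmallLift` from the per-`L` clauses at `L = 3` (the fleet's
  CertL3Tree lane) and at every odd `L ≥ 5` (ANSATZ T + the Γ-leg assembly; or ANSATZ S for `L ≤ 19`) — all other `L` carry no `T3Family`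
  (`F.hL : Odd F.L ∧ 1 < F.L`), via `oneStepSmallLift_stub_of_approx` (p454840).

Elementary; nothing of Bałaban's is asserted.
-/

noncomputable section

namespace Summit.QuantumFields.YangMills.Theorems.ApproxLift

open Literature.MathematicalPhysics.QuantumFieldTheory.Balaban1983to89
open Literature.MathematicalPhysics.QuantumFieldTheory.Balaban1983to89.T3ContinuumYM3Torus
open Literature.MathematicalPhysics.QuantumFieldTheory.Balaban1983to89.T3UnitLawDensityEML (ℰp)
open Literature.MathematicalPhysics.QuantumFieldTheory.Balaban1983to89.T3SmallLiftHistory (OneStepSmallLift)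

variable {P : Params} {n : Type*}
variable {R : ℕ} {kz : Fin P.d → (Fin P.d → Fin P.L) → Orient P.d → (Fin P.d → Fin (2 * R + 1)) → ℝ}

/-- **p2's `SliceNeutral` IS `TransverseNeutral`** (same formula), hence gives line-neutrality. -/
theorem lineNeutral_of_sliceNeutral (h : AnsatzT.SliceNeutral R kz) : LineNeutral (n := n) R kz :=
  lineNeutral_of_transverseNeutral fun a o k q => h a o k q

/-- `TransverseNeutral ↔ SliceNeutral` (bookkeeping). -/
theorem transverseNeutral_iff_sliceNeutral : TransverseNeutral R kz ↔ AnsatzT.SliceNeutral R kz := Iff.rfl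

/-- **THE REGISTERED SIGNATURE OF `stub_oneStepSmallLift` FROM THE PER-`L` CLAUSES AT `L = 3` AND AT EVERY ODD `L ≥ 5`**
(no `T3Family` has any other block size). -/
theorem oneStepSmallLift_stub_of_perL
    (h3 : ∃ κ₀ C δ₀ : ℝ, 0 ≤ κ₀ ∧ κ₀ * Real.sqrt (3 : ℕ) < 1 ∧ 0 ≤ C ∧ 0 < δ₀ ∧ ∀ F : T3Family, F.L = 3 → ApproxSmallLift F κ₀ C δ₀)
    (h5 : ∀ L : ℕ, Odd L → 5 ≤ L → ∃ κ₀ C δ₀ : ℝ, 0 ≤ κ₀ ∧ κ₀ * Real.sqrt L < 1 ∧ 0 ≤ C ∧ 0 < δ₀ ∧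
      ∀ F : T3Family, F.L = L → ApproxSmallLift F κ₀ C δ₀) :
    ∀ L : ℕ, ∃ κ δ₀ : ℝ, κ * Real.sqrt L ≤ 1 ∧ 0 < δ₀ ∧ ∀ F : T3Family, F.L = L → OneStepSmallLift F ℰp κ δ₀ := by
  refine oneStepSmallLift_stub_of_approx fun L => ?_
  by_cases hL3 : L = 3
  · subst hL3; exact h3
  by_cases hL5 : Odd L ∧ 5 ≤ L
  · exact h5 L hL5.1 hL5.2
  · -- no family has this block size
    refine ⟨0, 0, 1, le_rfl, by rw [zero_mul]; exact one_pos, le_rfl, one_pos, fun F hF => ?_⟩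
    exfalso
    have hodd : Odd F.L := F.hL.1
    have hgt : 1 < F.L := F.hL.2
    rw [hF] at hodd hgt
    obtain ⟨k, hk⟩ := hodd
    apply hL5
    refine ⟨⟨k, hk⟩, ?_⟩
    omega

end Summit.QuantumFields.YangMills.Theorems.ApproxLift

end
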